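import Summits.NavierStokesRegularity.NavierStokesRegularity.Theses.CoreLogGas
import Summits.NavierStokesRegularity.NavierStokesRegularity.Theorems.CoreLogGasBlowupIsLocallyDrivenStubFarSupportGrad
import Summits.NavierStokesRegularity.NavierStokesRegularity.Theorems.CoreLogGasBlowupIsLocallyDrivenStubCentreGrad
import Summits.NavierStokesRegularity.NavierStokesRegularity.Theorems.CoreLogGasBlowupIsLocallyDrivenStubCurlIntegralBall
import Summits.NavierStokesRegularity.NavierStokesRegularity.Theorems.CoreLogGasBlowupIsLocallyDrivenStubEnstrophyControl
import Literature.Analysis.FluidPDE.Vorticity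
import Literature.Analysis.FluidPDE.BallCutoff
import Literature.Analysis.FluidPDE.BiotSavartIntegral
import Literature.Analysis.FluidPDE.BiotSavartGradient
import Literature.Analysis.FluidPDE.VorticityCalculus
import Literature.Analysis.FluidPDE.CollapseDebris

/-!
# Crux `CoreLogGas.BlowupIsLocallyDriven` (stmt-NavierStokesRegularity-11291), line `registered`:
# the far-field strain bound and the reduction of the crux to shell locality

`--supports stmt-NavierStokesRegularity-11291` (lead `prover-line-stmt-NavierStokesRegularity-11291-c1-0`, 2026-08-17).
The crux B (`Theses.CoreLogGas.BlowupIsLocallyDriven`) bounds, at every deep near-maximum vorticity point `x` with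
canonical core radius `ρ` of a maximal finite-energy classical solution, the symmetric part of the velocity gradient
induced at `x` by the vorticity OUTSIDE `B(x, Mρ)` by a time-integrable `g`. The lead's skeleton
(`Cruxes/BlowupIsLocallyDriven/Lines/registered.lean`) cuts that exterior at a fixed macroscopic radius `R` into the
FAR FIELD `{|y − x| ≥ R}` and the SHELL `{Mρ ≤ |y − x| < R}`. This file lands everything except the shell:

* `farFieldStrain` — **the far-field strain bound** (unconditional): for a smooth divergence-free `v ∈ L²(EuclideanSpace ℝ (Fin 3))` with
  `∇v ∈ L²`, every radius `S > 0`, centre `x` and unit vector `e`,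
  `|⟪(∇v(x) − ∇BS[1_{B(x,S)} curl v](x)) e, e⟫| ≤ C (√((S/3)⁻⁵) ‖v‖₂ + √((S/3)⁻³) ‖∇v‖₂)` with an absolute `C`,
  where `BS` is the Biot–Savart velocity written out exactly as in the crux (`= Literature.Analysis.FluidPDE.biotSavart`
  by `rfl`). Proof: the LOCAL harmonic-remainder route — with `r = S/3` and the in-tree cutoff `ψ = ballCutoff x r`
  split `1_{B(x,S)}ω = ψω + F`, `F` vanishing on `B(x,2r)`; `∇v(x) − ∇BS[ψω](x)` is Tao's local Biot–Savart law at the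
  centre (`stub_centreGrad`), `∇BS[F](x)` is the far-support bound (`stub_farSupportGrad`) with
  `‖F‖₁ ≤ ∫_{B(x,S)}|ω| ≤ C √(r³) ‖∇v‖₂` (`stub_curlIntegralBall`). No global Biot–Savart representation theorem is
  used (the crux's solutions need not decay at spatial infinity for `t > 0`).
* `blowupIsLocallyDriven_of_shellLocality` — **B follows from shell locality alone**: the crux BY NAME from the one
  remaining registered stub statement `stub_intermediateZone` (taken as an explicit hypothesis), using `farFieldStrain`,
  the energy bound `∫‖u(t)‖² ≤ ∫‖u(0)‖²` of the Leray–Hopf energy inequality, and finite / time-integrable enstrophy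
  at every `t < T` (`stub_enstrophyControl`): `g := |g₁| + C (√((R/3)⁻⁵) ‖u 0‖₂ + √((R/3)⁻³) ‖∇u(t)‖₂)`.

References: T. Tao, arXiv:1108.1165 §10 (local Biot–Savart law); A. J. Majda, A. L. Bertozzi, *Vorticity and
Incompressible Flow* (CUP 2002), §2.4 (Biot–Savart kernel).
-/

noncomputable section

open Set MeasureTheory Filter Topology Metric
open scoped ContDiff

-- justification: the stub namespace is fixed by the crux protocol (sibling stub files use the same one).
set_option linter.dupNamespace false

namespace Summit.NavierStokesRegularity.NavierStokesRegularity.Theorems.BlowupIsLocallyDriven.Registered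

open Literature.Analysis.FluidPDE

/-! ### Elementary lemmas -/

/-- Three-term split of a quadratic form: `A − C = (A − B) + (B − C)` inside `|⟪· e, e⟫|`. [folklore] -/
theorem farField_abs_inner_sub_le_split
    (A B C : EuclideanSpace ℝ (Fin 3) →L[ℝ] EuclideanSpace ℝ (Fin 3)) (e : EuclideanSpace ℝ (Fin 3)) :
    |inner ℝ ((A - C) e) e| ≤ |inner ℝ ((A - B) e) e| + |inner ℝ ((B - C) e) e| := by
  have h : (A - C) e = (A - B) e + (B - C) e := by
    change A e - C e = (A e - B e) + (B e - C e); abel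
  rw [h, inner_add_left]
  exact abs_add_le _ _

/-- `|⟪L e, e⟫| ≤ ‖L‖` for a unit vector `e`. [folklore] -/
theorem farField_abs_inner_apply_self_le_opNorm (L : EuclideanSpace ℝ (Fin 3) →L[ℝ] EuclideanSpace ℝ (Fin 3))
    (e : EuclideanSpace ℝ (Fin 3)) (he : ‖e‖ = 1) : |inner ℝ (L e) e| ≤ ‖L‖ := by
  calc |inner ℝ (L e) e| ≤ ‖L e‖ * ‖e‖ := abs_real_inner_le_norm _ _
    _ ≤ ‖L‖ * ‖e‖ * ‖e‖ := by gcongr; exact L.le_opNorm e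
    _ = ‖L‖ := by rw [he]; ring

/-- Energy decay of an unforced Leray–Hopf solution in Bochner form: `∫‖u t‖² ≤ ∫‖u 0‖²` on `[0,T]`
(Leray 1934, (5.2): the energy inequality from `0` with zero force). [folklore] -/
theorem farField_integral_norm_sq_le_datum {T ν : ℝ} {u : ℝ → EuclideanSpace ℝ (Fin 3) → EuclideanSpace ℝ (Fin 3)}
    (hlh : Literature.Analysis.FluidPDE.IsLerayHopfOn T ν 0 (u 0) u) (hν : 0 ≤ ν)
    {t : ℝ} (ht : t ∈ Icc 0 T) :
    ∫ y, ‖u t y‖ ^ 2 ≤ ∫ y, ‖u 0 y‖ ^ 2 := by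
  obtain ⟨G, -, -, hE, -⟩ := hlh.weakGrad_energy
  have h1 := hE t ht
  simp only [Pi.zero_apply, inner_zero_left, integral_zero, intervalIntegral.integral_zero,
    add_zero] at h1
  have hK : Literature.Analysis.FluidPDE.VectorCalculus.kineticEnergy (u t) ≤
      Literature.Analysis.FluidPDE.VectorCalculus.kineticEnergy (u 0) :=
    le_trans (le_add_of_nonneg_right (mul_nonneg hν ENNReal.toReal_nonneg)) h1
  unfold Literature.Analysis.FluidPDE.VectorCalculus.kineticEnergy at hK
  linarith

/-- The written-out Biot–Savart velocity of the crux is the in-tree `biotSavart` (definitional). [folklore] -/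
theorem farField_inlined_eq_biotSavart (F : EuclideanSpace ℝ (Fin 3) → EuclideanSpace ℝ (Fin 3)) :
    (fun z : EuclideanSpace ℝ (Fin 3) => ∫ y, (4 * Real.pi * ‖z - y‖ ^ 3)⁻¹ • Literature.Analysis.FluidPDE.cross (F y) (z - y)) =
      Literature.Analysis.FluidPDE.biotSavart F := rfl

/-! ### The far-field strain bound -/

/-- **Far-field strain bound.** For a smooth divergence-free `v ∈ L²(EuclideanSpace ℝ (Fin 3))` with `∇v ∈ L²`, every radius `S > 0`,
centre `x` and unit `e`: `|⟪(∇v(x) − ∇BS[1_{B(x,S)} curl v](x)) e, e⟫| ≤ C (√((S/3)⁻⁵) ‖v‖₂ + √((S/3)⁻³) ‖∇v‖₂)`,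
`C` absolute — the symmetric velocity gradient induced at `x` by the vorticity outside `B(x,S)` is controlled by the
energy and the enstrophy with the scale-invariant weights `S^{-5/2}`, `S^{-3/2}` (Tao 2011 §10 local Biot–Savart law
at the centre + the far-support kernel bound; see the module docstring). [cite: Tao2011, §10, proof of Thm. 10.1 (p. 32)] -/
theorem farFieldStrain :
    ∃ C : ℝ, 0 ≤ C ∧ ∀ (v : EuclideanSpace ℝ (Fin 3) → EuclideanSpace ℝ (Fin 3)),
      ContDiff ℝ ∞ v → Literature.Analysis.FluidPDE.VectorCalculus.IsDivFree v →
      MeasureTheory.MemLp v 2 MeasureTheory.volume →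
      MeasureTheory.Integrable (fun y => ‖fderiv ℝ v y‖ ^ 2) MeasureTheory.volume →
      ∀ (S : ℝ), 0 < S → ∀ (x e : EuclideanSpace ℝ (Fin 3)), ‖e‖ = 1 →
        |inner ℝ ((fderiv ℝ v x - fderiv ℝ (fun z : EuclideanSpace ℝ (Fin 3) => ∫ y, (4 * Real.pi * ‖z - y‖ ^ 3)⁻¹ • Literature.Analysis.FluidPDE.cross ((Metric.ball x S).indicator (Literature.Analysis.FluidPDE.curl v) y) (z - y)) x) e) e|
          ≤ C * (Real.sqrt ((S / 3)⁻¹ ^ 5) * Real.sqrt (∫ y, ‖v y‖ ^ 2) +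
              Real.sqrt ((S / 3)⁻¹ ^ 3) * Real.sqrt (∫ y, ‖fderiv ℝ v y‖ ^ 2)) := by
  obtain ⟨A, hA0, hA⟩ := stub_farSupportGrad
  obtain ⟨C₂, hC20, hC2⟩ := stub_centreGrad
  obtain ⟨C₃, hC30, hC3⟩ := stub_curlIntegralBall
  refine ⟨C₂ + (C₂ + A) * C₃, by positivity, ?_⟩
  intro v hv hdiv hL2 hgrad S hS x e he
  -- the radius of the cutoff: `r = S/3` (kept opaque)
  obtain ⟨r, hr_def⟩ : ∃ r : ℝ, r = S / 3 := ⟨_, rfl⟩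
  have hr : 0 < r := by rw [hr_def]; positivity
  have h3r : 3 * r = S := by rw [hr_def]; ring
  have hv1 : ContDiff ℝ 1 v := hv.of_le (by exact_mod_cast le_top)
  have hwc : Continuous (Literature.Analysis.FluidPDE.curl v) := continuous_curl hv1
  have hwm : Measurable (Literature.Analysis.FluidPDE.curl v) := measurable_curl v
  have hψc : Continuous (Literature.Analysis.FluidPDE.ballCutoff x r) := (contDiff_ballCutoff x r (n := 0)).continuous
  have hψs : HasCompactSupport (Literature.Analysis.FluidPDE.ballCutoff x r) := hasCompactSupport_ballCutoff hr
  have hψ0 : ∀ y, y ∉ Metric.ball x S → Literature.Analysis.FluidPDE.ballCutoff x r y = 0 := by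
    intro y hy
    rw [Metric.mem_ball, dist_eq_norm, not_lt, ← h3r] at hy
    exact ballCutoff_eq_zero hr hy
  -- a bound for `curl v` on the closed ball `B̄(x,S)`
  obtain ⟨B, hB⟩ := (isCompact_closedBall x S).exists_bound_of_continuousOn hwc.continuousOn
  have hB0 : 0 ≤ B := (norm_nonneg _).trans (hB x (mem_closedBall_self hS.le))
  -- the localised vorticity `G = ψ • curl v` (opaque name)
  obtain ⟨G, hG_def⟩ : ∃ G : EuclideanSpace ℝ (Fin 3) → EuclideanSpace ℝ (Fin 3),
      G = fun y => Literature.Analysis.FluidPDE.ballCutoff x r y • Literature.Analysis.FluidPDE.curl v y := ⟨_, rfl⟩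
  have hGc : Continuous G := by rw [hG_def]; exact hψc.smul hwc
  have hGs : HasCompactSupport G := by rw [hG_def]; exact hψs.smul_right
  have hGi : Integrable G := hGc.integrable_of_hasCompactSupport hGs
  have hGm : Measurable G := hGc.measurable
  have hGb : ∀ y, ‖G y‖ ≤ B := by
    intro y
    rw [hG_def]
    by_cases hy : y ∈ Metric.ball x S
    · calc ‖Literature.Analysis.FluidPDE.ballCutoff x r y • Literature.Analysis.FluidPDE.curl v y‖
          = |Literature.Analysis.FluidPDE.ballCutoff x r y| * ‖Literature.Analysis.FluidPDE.curl v y‖ := norm_smul _ _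
        _ ≤ 1 * ‖Literature.Analysis.FluidPDE.curl v y‖ :=
          mul_le_mul_of_nonneg_right (abs_ballCutoff_le_one x r y) (norm_nonneg _)
        _ ≤ B := by rw [one_mul]; exact hB y (ball_subset_closedBall hy)
    · simp [hψ0 y hy, hB0]
  -- the annular remainder `F = (1_{B(x,S)} − ψ) curl v` (opaque name)
  obtain ⟨F, hF_def⟩ : ∃ F : EuclideanSpace ℝ (Fin 3) → EuclideanSpace ℝ (Fin 3),
      F = fun y => (Metric.ball x S).indicator (Literature.Analysis.FluidPDE.curl v) y - G y := ⟨_, rfl⟩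
  have hwB : IntegrableOn (Literature.Analysis.FluidPDE.curl v) (Metric.ball x S) :=
    (hwc.continuousOn.integrableOn_compact (isCompact_closedBall x S)).mono_set ball_subset_closedBall
  have hwBn : IntegrableOn (fun y => ‖Literature.Analysis.FluidPDE.curl v y‖) (Metric.ball x S) := hwB.norm
  have hIi : Integrable ((Metric.ball x S).indicator (Literature.Analysis.FluidPDE.curl v)) :=
    hwB.integrable_indicator measurableSet_ball
  have hFi : Integrable F := by rw [hF_def]; exact hIi.sub hGi
  have hFm : Measurable F := by rw [hF_def]; exact (hwm.indicator measurableSet_ball).sub hGm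
  have hFle : ∀ y, ‖F y‖ ≤ (Metric.ball x S).indicator (fun y => ‖Literature.Analysis.FluidPDE.curl v y‖) y := by
    intro y
    rw [hF_def, hG_def]
    beta_reduce
    by_cases hy : y ∈ Metric.ball x S
    · have h01 := And.intro (ballCutoff_nonneg x r y) (ballCutoff_le_one x r y)
      have : (Metric.ball x S).indicator (Literature.Analysis.FluidPDE.curl v) y -
          Literature.Analysis.FluidPDE.ballCutoff x r y • Literature.Analysis.FluidPDE.curl v y =
          (1 - Literature.Analysis.FluidPDE.ballCutoff x r y) • Literature.Analysis.FluidPDE.curl v y := by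
        rw [indicator_of_mem hy, sub_smul, one_smul]
      rw [this, indicator_of_mem hy, norm_smul, Real.norm_eq_abs, abs_of_nonneg (by linarith [h01.2])]
      calc (1 - Literature.Analysis.FluidPDE.ballCutoff x r y) * ‖Literature.Analysis.FluidPDE.curl v y‖
          ≤ 1 * ‖Literature.Analysis.FluidPDE.curl v y‖ :=
            mul_le_mul_of_nonneg_right (by linarith [h01.1]) (norm_nonneg _)
        _ = ‖Literature.Analysis.FluidPDE.curl v y‖ := one_mul _
    · simp [indicator_of_notMem hy, hψ0 y hy]
  have hFb : ∀ y, ‖F y‖ ≤ B := by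
    intro y
    refine (hFle y).trans ?_
    by_cases hy : y ∈ Metric.ball x S
    · rw [indicator_of_mem hy]; exact hB y (ball_subset_closedBall hy)
    · rw [indicator_of_notMem hy]; exact hB0
  have hF0 : ∀ y ∈ Metric.ball x (2 * r), F y = 0 := by
    intro y hy
    have hyS : y ∈ Metric.ball x S := by
      refine ball_subset_ball ?_ hy
      rw [← h3r]; linarith
    have hψ1 : Literature.Analysis.FluidPDE.ballCutoff x r y = 1 := by
      rw [Metric.mem_ball, dist_eq_norm] at hy
      exact ballCutoff_eq_one hr hy.le
    rw [hF_def, hG_def]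
    simp [indicator_of_mem hyS, hψ1]
  have hFL1 : ∫ y, ‖F y‖ ≤ ∫ y in Metric.ball x S, ‖Literature.Analysis.FluidPDE.curl v y‖ := by
    rw [← integral_indicator measurableSet_ball]
    exact integral_mono hFi.norm (hwBn.integrable_indicator measurableSet_ball) hFle
  -- the decomposition `BS[1_{B(x,S)} curl v] = BS[G] + BS[F]` (everywhere)
  have hsplit : Literature.Analysis.FluidPDE.biotSavart ((Metric.ball x S).indicator (Literature.Analysis.FluidPDE.curl v)) =
      Literature.Analysis.FluidPDE.biotSavart G + Literature.Analysis.FluidPDE.biotSavart F := by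
    funext z
    simp only [Pi.add_apply, Literature.Analysis.FluidPDE.biotSavart]
    rw [← integral_add (integrable_biotSavartKernel_sub_apply hGm hGi hGb z)
      (integrable_biotSavartKernel_sub_apply hFm hFi hFb z)]
    refine integral_congr_ae (Eventually.of_forall fun y => ?_)
    have hGF : (Metric.ball x S).indicator (Literature.Analysis.FluidPDE.curl v) y = G y + F y := by
      simp only [hF_def]; abel
    beta_reduce
    rw [hGF, ← biotSavartCLM_apply, ← biotSavartCLM_apply, ← biotSavartCLM_apply, map_add]
  -- the three stubs at `(v, x, r)`
  have h2 := hC2 v hv hdiv (hL2.integrable_norm_pow two_ne_zero) x r hr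
  rw [← hG_def, h3r] at h2
  obtain ⟨hdG, hG⟩ := h2
  obtain ⟨hdF, hF⟩ := hA F x (2 * r) (by positivity) hFi hF0
  have h3 := hC3 v hv1 hgrad x r hr
  rw [h3r] at h3
  -- assemble the operator-norm bound
  have hI0 : 0 ≤ ∫ y in Metric.ball x S, ‖Literature.Analysis.FluidPDE.curl v y‖ := integral_nonneg fun _ => norm_nonneg _
  have hr3 : ((2 * r) ^ 3)⁻¹ ≤ (r ^ 3)⁻¹ := by
    apply inv_anti₀ (by positivity)
    exact pow_le_pow_left₀ hr.le (by linarith) 3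
  have hfd : fderiv ℝ (Literature.Analysis.FluidPDE.biotSavart ((Metric.ball x S).indicator (Literature.Analysis.FluidPDE.curl v))) x =
      fderiv ℝ (Literature.Analysis.FluidPDE.biotSavart G) x + fderiv ℝ (Literature.Analysis.FluidPDE.biotSavart F) x := by
    rw [hsplit]; exact fderiv_add hdG hdF
  have hFfar : A * ((2 * r) ^ 3)⁻¹ * ∫ y, ‖F y‖ ≤ A * (r ^ 3)⁻¹ * ∫ y in Metric.ball x S, ‖Literature.Analysis.FluidPDE.curl v y‖ :=
    mul_le_mul (mul_le_mul_of_nonneg_left hr3 hA0) hFL1 (integral_nonneg fun _ => norm_nonneg _) (by positivity)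
  have hkey : ‖fderiv ℝ v x - fderiv ℝ (Literature.Analysis.FluidPDE.biotSavart ((Metric.ball x S).indicator (Literature.Analysis.FluidPDE.curl v))) x‖ ≤
      C₂ * (Real.sqrt (r⁻¹ ^ 5) * Real.sqrt (∫ y, ‖v y‖ ^ 2)) +
        (C₂ + A) * ((r ^ 3)⁻¹ * ∫ y in Metric.ball x S, ‖Literature.Analysis.FluidPDE.curl v y‖) := by
    rw [hfd, sub_add_eq_sub_sub]
    refine (norm_sub_le _ _).trans ?_
    refine (add_le_add hG hF).trans ?_
    refine (add_le_add le_rfl hFfar).trans ?_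
    exact le_of_eq (by ring)
  -- `∫_{B(x,S)} |curl v| ≤ C₃ √(r³) ‖∇v‖₂` and `(r³)⁻¹ √(r³) = √(r⁻¹ ^ 3)`
  have hr33 : (r ^ 3)⁻¹ * Real.sqrt (r ^ 3) = Real.sqrt (r⁻¹ ^ 3) := by
    have hr3' : 0 < r ^ 3 := by positivity
    have hs : 0 < Real.sqrt (r ^ 3) := Real.sqrt_pos.2 hr3'
    have hss : Real.sqrt (r ^ 3) * Real.sqrt (r ^ 3) = r ^ 3 := Real.mul_self_sqrt hr3'.le
    rw [inv_pow, Real.sqrt_inv]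
    conv_lhs => arg 1; rw [← hss]
    rw [mul_inv, mul_assoc, inv_mul_cancel₀ hs.ne', mul_one]
  have hshell : (r ^ 3)⁻¹ * ∫ y in Metric.ball x S, ‖Literature.Analysis.FluidPDE.curl v y‖ ≤
      C₃ * (Real.sqrt (r⁻¹ ^ 3) * Real.sqrt (∫ y, ‖fderiv ℝ v y‖ ^ 2)) := by
    calc (r ^ 3)⁻¹ * ∫ y in Metric.ball x S, ‖Literature.Analysis.FluidPDE.curl v y‖
        ≤ (r ^ 3)⁻¹ * (C₃ * Real.sqrt (r ^ 3) * Real.sqrt (∫ y, ‖fderiv ℝ v y‖ ^ 2)) :=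
          mul_le_mul_of_nonneg_left h3 (by positivity)
      _ = C₃ * ((r ^ 3)⁻¹ * Real.sqrt (r ^ 3) * Real.sqrt (∫ y, ‖fderiv ℝ v y‖ ^ 2)) := by ring
      _ = C₃ * (Real.sqrt (r⁻¹ ^ 3) * Real.sqrt (∫ y, ‖fderiv ℝ v y‖ ^ 2)) := by rw [hr33]
  -- conclude
  have hinl := farField_inlined_eq_biotSavart ((Metric.ball x S).indicator (Literature.Analysis.FluidPDE.curl v))
  rw [hinl, ← hr_def]
  have hx1 : 0 ≤ Real.sqrt (r⁻¹ ^ 5) * Real.sqrt (∫ y, ‖v y‖ ^ 2) := mul_nonneg (Real.sqrt_nonneg _) (Real.sqrt_nonneg _)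
  have hx2 : 0 ≤ Real.sqrt (r⁻¹ ^ 3) * Real.sqrt (∫ y, ‖fderiv ℝ v y‖ ^ 2) := mul_nonneg (Real.sqrt_nonneg _) (Real.sqrt_nonneg _)
  have hc1 : C₂ ≤ C₂ + (C₂ + A) * C₃ := le_add_of_nonneg_right (by positivity)
  have hc2 : (C₂ + A) * C₃ ≤ C₂ + (C₂ + A) * C₃ := le_add_of_nonneg_left hC20
  calc |inner ℝ ((fderiv ℝ v x - fderiv ℝ (Literature.Analysis.FluidPDE.biotSavart ((Metric.ball x S).indicator (Literature.Analysis.FluidPDE.curl v))) x) e) e|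
      ≤ ‖fderiv ℝ v x - fderiv ℝ (Literature.Analysis.FluidPDE.biotSavart ((Metric.ball x S).indicator (Literature.Analysis.FluidPDE.curl v))) x‖ :=
        farField_abs_inner_apply_self_le_opNorm _ e he
    _ ≤ C₂ * (Real.sqrt (r⁻¹ ^ 5) * Real.sqrt (∫ y, ‖v y‖ ^ 2)) +
          (C₂ + A) * ((r ^ 3)⁻¹ * ∫ y in Metric.ball x S, ‖Literature.Analysis.FluidPDE.curl v y‖) := hkey
    _ ≤ C₂ * (Real.sqrt (r⁻¹ ^ 5) * Real.sqrt (∫ y, ‖v y‖ ^ 2)) +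
          (C₂ + A) * (C₃ * (Real.sqrt (r⁻¹ ^ 3) * Real.sqrt (∫ y, ‖fderiv ℝ v y‖ ^ 2))) :=
        add_le_add le_rfl (mul_le_mul_of_nonneg_left hshell (by positivity))
    _ = C₂ * (Real.sqrt (r⁻¹ ^ 5) * Real.sqrt (∫ y, ‖v y‖ ^ 2)) +
          ((C₂ + A) * C₃) * (Real.sqrt (r⁻¹ ^ 3) * Real.sqrt (∫ y, ‖fderiv ℝ v y‖ ^ 2)) := by ring
    _ ≤ (C₂ + (C₂ + A) * C₃) * (Real.sqrt (r⁻¹ ^ 5) * Real.sqrt (∫ y, ‖v y‖ ^ 2)) +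
          (C₂ + (C₂ + A) * C₃) * (Real.sqrt (r⁻¹ ^ 3) * Real.sqrt (∫ y, ‖fderiv ℝ v y‖ ^ 2)) :=
        add_le_add (mul_le_mul_of_nonneg_right hc1 hx1) (mul_le_mul_of_nonneg_right hc2 hx2)
    _ = (C₂ + (C₂ + A) * C₃) * (Real.sqrt (r⁻¹ ^ 5) * Real.sqrt (∫ y, ‖v y‖ ^ 2) +
          Real.sqrt (r⁻¹ ^ 3) * Real.sqrt (∫ y, ‖fderiv ℝ v y‖ ^ 2)) := by ring


/-! ### The crux follows from shell locality -/

/-- **`BlowupIsLocallyDriven` follows from shell locality alone.** If every maximal finite-energy classical solution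
from Clay data admits `M ≥ 1`, `t₀ < T`, `R > 0` and an integrable `g₁` bounding, at every deep near-maximum vorticity
point `x` with canonical core radius `ρ`, `Mρ ≤ R`, the symmetric gradient induced at `x` by the vorticity in the SHELL
`B(x,R) ∖ B(x,Mρ)` (the registered stub `stub_intermediateZone` of line `registered`, taken here as the hypothesis
`hI`), then the crux B holds: `g := |g₁| + C (√((R/3)⁻⁵) ‖u 0‖₂ + √((R/3)⁻³) ‖∇u(t)‖₂)` works, by `farFieldStrain`
at radius `R` (resp. `Mρ` when `Mρ > R`, by antitonicity in the radius), the energy bound and `stub_enstrophyControl`.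
[folklore] -/
theorem blowupIsLocallyDriven_of_shellLocality
    (hI : ∀ (ν T : ℝ), 0 < ν → 0 < T →
    ∀ (u : ℝ → EuclideanSpace ℝ (Fin 3) → EuclideanSpace ℝ (Fin 3)) (p : ℝ → EuclideanSpace ℝ (Fin 3) → ℝ),
      Literature.Analysis.FluidPDE.IsMaximalSmoothSolution ν 0 u p T →
      Literature.Analysis.FluidPDE.IsLerayHopfOn T ν 0 (u 0) u →
      Literature.Analysis.FluidPDE.HasRapidSpatialDecay (u 0) →
      ∃ (M t₀ R : ℝ) (g₁ : ℝ → ℝ), 1 ≤ M ∧ 0 ≤ t₀ ∧ t₀ < T ∧ 0 < R ∧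
        MeasureTheory.IntegrableOn g₁ (Set.Ico t₀ T) ∧
        ∀ t ∈ Set.Ico t₀ T, ∀ (x : EuclideanSpace ℝ (Fin 3)) (ρ : ℝ), 0 < ρ → M * ρ ≤ R →
          (⨆ z, ‖Literature.Analysis.FluidPDE.curl (u t) z‖) ≤ 2 * ‖Literature.Analysis.FluidPDE.curl (u t) x‖ →
          Metric.ball x ρ ⊆ {y | (⨆ z, ‖Literature.Analysis.FluidPDE.curl (u t) z‖) ≤ 4 * ‖Literature.Analysis.FluidPDE.curl (u t) y‖} →
          (∀ (x' : EuclideanSpace ℝ (Fin 3)) (ρ' : ℝ),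
            (⨆ z, ‖Literature.Analysis.FluidPDE.curl (u t) z‖) ≤ 2 * ‖Literature.Analysis.FluidPDE.curl (u t) x'‖ →
            Metric.ball x' ρ' ⊆ {y | (⨆ z, ‖Literature.Analysis.FluidPDE.curl (u t) z‖) ≤ 4 * ‖Literature.Analysis.FluidPDE.curl (u t) y‖} →
            ρ' ≤ 2 * ρ) →
          ∀ e : EuclideanSpace ℝ (Fin 3), ‖e‖ = 1 →
            |inner ℝ ((fderiv ℝ (fun z : EuclideanSpace ℝ (Fin 3) => ∫ y, (4 * Real.pi * ‖z - y‖ ^ 3)⁻¹ • Literature.Analysis.FluidPDE.cross ((Metric.ball x R).indicator (Literature.Analysis.FluidPDE.curl (u t)) y) (z - y)) x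
              - fderiv ℝ (fun z : EuclideanSpace ℝ (Fin 3) => ∫ y, (4 * Real.pi * ‖z - y‖ ^ 3)⁻¹ • Literature.Analysis.FluidPDE.cross ((Metric.ball x (M * ρ)).indicator (Literature.Analysis.FluidPDE.curl (u t)) y) (z - y)) x) e) e|
              ≤ g₁ t) :
    Summit.NavierStokesRegularity.NavierStokesRegularity.Theses.CoreLogGas.BlowupIsLocallyDriven := by
  intro ν T hν hT u p hmax hlh hdec
  obtain ⟨C, hC0, hC⟩ := farFieldStrain
  have hcl : Literature.Analysis.FluidPDE.IsClassicalNSSolutionOn (Set.Ico 0 T) ν 0 u p := hmax.1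
  obtain ⟨hint, hsq⟩ := stub_enstrophyControl ν T hν hT u p hcl hlh hdec
  obtain ⟨M, t₀, R, g₁, hM, ht₀, ht₀T, hR, hg₁, hH⟩ := hI ν T hν hT u p hmax hlh hdec
  -- the far-field majorant at radius `R` (opaque name)
  obtain ⟨Φ, hΦ⟩ : ∃ Φ : ℝ → ℝ, Φ = fun t => C * (Real.sqrt ((R / 3)⁻¹ ^ 5) * Real.sqrt (∫ y, ‖u 0 y‖ ^ 2) +
      Real.sqrt ((R / 3)⁻¹ ^ 3) * Real.sqrt (∫ y, ‖fderiv ℝ (u t) y‖ ^ 2)) := ⟨_, rfl⟩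
  refine ⟨M, t₀, fun t => |g₁ t| + Φ t, hM, ht₀, ht₀T, ?_, ?_⟩
  · -- integrability of g on [t₀, T)
    have hsub : Set.Ico t₀ T ⊆ Set.Ico 0 T := Set.Ico_subset_Ico_left ht₀
    have hN : MeasureTheory.IntegrableOn (fun t => Real.sqrt (∫ y, ‖fderiv ℝ (u t) y‖ ^ 2)) (Set.Ico t₀ T)
        MeasureTheory.volume := hsq.mono_set hsub
    have hΦi : MeasureTheory.IntegrableOn Φ (Set.Ico t₀ T) MeasureTheory.volume := by
      have h1 : MeasureTheory.IntegrableOn (fun _ : ℝ => Real.sqrt ((R / 3)⁻¹ ^ 5) * Real.sqrt (∫ y, ‖u 0 y‖ ^ 2))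
          (Set.Ico t₀ T) MeasureTheory.volume := integrableOn_const (by simp)
      rw [hΦ]
      exact ((h1.add (hN.integrable.const_mul _)).integrable.const_mul C)
    exact hg₁.integrable.abs.add hΦi
  · intro t ht x ρ hρ hpeak hball hmaxrad e he
    -- classical facts at the time slice t
    have ht' : t ∈ Set.Ico 0 T := ⟨ht₀.trans ht.1, ht.2⟩
    have hCi : ContDiff ℝ ∞ (u t) := hcl.contDiff_velocity ht'
    have hdiv : Literature.Analysis.FluidPDE.VectorCalculus.IsDivFree (u t) := hcl.divFree t ht'
    have hL2 : MeasureTheory.MemLp (u t) 2 MeasureTheory.volume := hlh.memLp t ⟨ht'.1, ht'.2.le⟩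
    have hgrad : MeasureTheory.Integrable (fun y => ‖fderiv ℝ (u t) y‖ ^ 2) MeasureTheory.volume := hint t ht'
    -- energy: `‖u t‖₂ ≤ ‖u 0‖₂`
    have hen : Real.sqrt (∫ y, ‖u t y‖ ^ 2) ≤ Real.sqrt (∫ y, ‖u 0 y‖ ^ 2) :=
      Real.sqrt_le_sqrt (farField_integral_norm_sq_le_datum hlh hν.le ⟨ht'.1, ht'.2.le⟩)
    -- the far-field bound at any radius `S ≥ R` is at most `Φ t`
    have hfar : ∀ S : ℝ, R ≤ S →
        |inner ℝ ((fderiv ℝ (u t) x - fderiv ℝ (fun z : EuclideanSpace ℝ (Fin 3) => ∫ y, (4 * Real.pi * ‖z - y‖ ^ 3)⁻¹ • Literature.Analysis.FluidPDE.cross ((Metric.ball x S).indicator (Literature.Analysis.FluidPDE.curl (u t)) y) (z - y)) x) e) e|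
          ≤ Φ t := by
      intro S hRS
      have hS : 0 < S := hR.trans_le hRS
      refine (hC (u t) hCi hdiv hL2 hgrad S hS x e he).trans ?_
      have hmono : ∀ k : ℕ, Real.sqrt ((S / 3)⁻¹ ^ k) ≤ Real.sqrt ((R / 3)⁻¹ ^ k) := by
        intro k
        apply Real.sqrt_le_sqrt
        apply pow_le_pow_left₀ (by positivity)
        exact inv_anti₀ (by positivity) (by linarith)
      rw [hΦ]
      have hb0 : 0 ≤ Real.sqrt (∫ y, ‖fderiv ℝ (u t) y‖ ^ 2) := Real.sqrt_nonneg _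
      have ha0 : 0 ≤ Real.sqrt (∫ y, ‖u 0 y‖ ^ 2) := Real.sqrt_nonneg _
      have hsS : 0 ≤ Real.sqrt ((S / 3)⁻¹ ^ 5) := Real.sqrt_nonneg _
      refine mul_le_mul_of_nonneg_left (add_le_add ?_ ?_) hC0
      · exact mul_le_mul (hmono 5) hen (Real.sqrt_nonneg _) (Real.sqrt_nonneg _)
      · exact mul_le_mul_of_nonneg_right (hmono 3) hb0
    show _ ≤ |g₁ t| + Φ t
    by_cases hcase : M * ρ ≤ R
    · -- split the exterior at radius R: far field + intermediate shell
      have h1 := hfar R le_rfl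
      have h2 := (hH t ht x ρ hρ hcase hpeak hball hmaxrad e he).trans (le_abs_self (g₁ t))
      exact (farField_abs_inner_sub_le_split _ _ _ e).trans ((add_le_add h1 h2).trans_eq (add_comm _ _))
    · -- the M-ball already contains B(x,R): the far-field bound applies directly at radius M ρ
      exact (hfar (M * ρ) (lt_of_not_ge hcase).le).trans (le_add_of_nonneg_left (abs_nonneg _))


end Summit.NavierStokesRegularity.NavierStokesRegularity.Theorems.BlowupIsLocallyDriven.Registered
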